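import Summits.CriticalPhenomena.PercolationContinuityZ3.Theorems.Transplant.FKConnectivityAllQPat3MinorData
import Summits.CriticalPhenomena.PercolationContinuityZ3.Theorems.Transplant.FKConnectivityAllQPat3SPSteps
import HarnessLib

/-!
# Connectivity correlation inequalities for `φ_{w,q}`, every `q > 0` — THEOREM SP on MINORS: the certified steps in `SPGoodC` form

Proof file (`--supports stmt-CriticalPhenomena-4575`), census lineage (gen 37) of LANE 2's FK sub-programme; builds on p205010
(kernel theorem, internal audit signed; external expert review pending).  No definitions, no named facts, no sorries.

The leaves of census g37's structural recursion for THEOREM SP, now for a MINOR `(E, C)` of the network (free set `E`, contracted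
set `C`, the rest deleted; both restricted to the pieces of every gluing): the one-sided one-vertex law on minors
(`FK.lev2C_union_oneSided_nonneg`), the two-marked-cut step (`FK.famT12C_par_step`), and the packaged leaves
`FK.spGoodC_inner/parTwo/cutS/cut1/oneSided/corner/theta/ring` — from census g37's `FK.famT12C_nonneg` (𝒯₁/𝒯₂ on minors) and the
certificate wrappers on minors of `…Pat3MinorData.lean`.  Pieces are ambient two-terminal series–parallel networks `N_i`; the
minor data are `E_i, C_i ⊆ N_i`; vertex sets are the spans of the `N_i`.
[cite: AyyerLinussonRavichandran2025, §7 (p. 22)] [cite: Grimmett2006, §3.8 (pp. 61–62)]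
-/

namespace Summit.CriticalPhenomena.PercolationContinuityZ3.Theorems

namespace FK

open SimpleGraph Literature.Probability.LatticeModels Literature.Probability.Percolation
open scoped Classical

variable {V : Type*}

/-! ### The one-sided one-vertex law on minors -/

section OneSidedC

variable {N₁ N₂ E₁ C₁ E₂ C₂ : Finset (Sym2 V)} {V₁ V₂ : Set V}

/-- **One-sided one-vertex gluing of minors, patterns**: with all three marks on the first piece, the pattern of the glued
minor-configuration is the pattern of its first part. [folklore] -/
theorem pat3C_union_oneSided (h₁ : ∀ e ∈ (↑N₁ : Set (Sym2 V)), ∀ z ∈ e, z ∈ V₁)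
    (h₂ : ∀ e ∈ (↑N₂ : Set (Sym2 V)), ∀ z ∈ e, z ∈ V₂) {m : V} (hS : V₁ ∩ V₂ ⊆ {m})
    (hC₁ : C₁ ⊆ N₁) (hC₂ : C₂ ⊆ N₂) {b s t : V} (hb : b ∉ V₂ ∨ b = m)
    (hs : s ∉ V₂ ∨ s = m) (ht : t ∉ V₂ ∨ t = m) (hbs : b ≠ s) (hbt : b ≠ t) (hst : s ≠ t) {γ₁ γ₂ : Finset (Sym2 V)}
    (hγ₁ : γ₁ ⊆ N₁) (hγ₂ : γ₂ ⊆ N₂) : pat3 (γ₁ ∪ C₁ ∪ (γ₂ ∪ C₂)) b s t = pat3 (γ₁ ∪ C₁) b s t :=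
  pat3_union_oneSided h₁ h₂ hS hb hs ht hbs hbt hst (Finset.union_subset hγ₁ hC₁) (Finset.union_subset hγ₂ hC₂)

variable [Fintype V]

/-- **One-sided one-vertex gluing law on minors, levelwise**: if a two-level table is levelwise nonnegative on the minor
`(E₁, C₁)` of the first piece and the second piece hangs at one vertex `m` with the marks on the first piece, then the table is
levelwise nonnegative on the glued minor `(E₁ ∪ E₂, C₁ ∪ C₂)`. [cite: AyyerLinussonRavichandran2025, §7 (p. 22)] -/
theorem lev2C_union_oneSided_nonneg (hdN : Disjoint N₁ N₂) (h₁ : ∀ e ∈ (↑N₁ : Set (Sym2 V)), ∀ z ∈ e, z ∈ V₁)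
    (h₂ : ∀ e ∈ (↑N₂ : Set (Sym2 V)), ∀ z ∈ e, z ∈ V₂) {m : V} (hS : V₁ ∩ V₂ ⊆ {m})
    (hE₁ : E₁ ⊆ N₁) (hC₁ : C₁ ⊆ N₁) (hE₂ : E₂ ⊆ N₂) (hC₂ : C₂ ⊆ N₂) {b s t : V} (hb : b ∉ V₂ ∨ b = m)
    (hs : s ∉ V₂ ∨ s = m) (ht : t ∉ V₂ ∨ t = m) (hbs : b ≠ s) (hbt : b ≠ t) (hst : s ≠ t) (F : ℕ → Pat3 → Pat3 → ℤ)
    (hA : ∀ μ : ℕ, 0 ≤ lev2C E₁ C₁ b s t F μ) (μ : ℕ) : 0 ≤ lev2C (E₁ ∪ E₂) (C₁ ∪ C₂) b s t F μ := by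
  have hd : Disjoint E₁ E₂ := Finset.disjoint_of_subset_left hE₁ (Finset.disjoint_of_subset_right hE₂ hdN)
  unfold lev2C
  rw [sum_powerset_union_disj hd, Finset.sum_comm]
  refine Finset.sum_nonneg fun γ₂ hγ₂ => ?_
  have g₂ := Finset.mem_powerset.1 hγ₂
  by_cases ha : apExpC E₂ C₂ γ₂ ≤ μ + 2 * Fintype.card V
  · have key := hA (μ + 2 * Fintype.card V - apExpC E₂ C₂ γ₂)
    unfold lev2C at key
    refine le_of_le_of_eq key (Finset.sum_congr rfl fun γ₁ hγ₁ => ?_)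
    have g₁ := Finset.mem_powerset.1 hγ₁
    have hexp := apExpC_series hdN h₁ h₂ hS hE₁ hE₂ hC₁ hC₂ g₁ g₂
    rw [Finset.union_union_union_comm, sdiff_union_union_distrib hd g₁ g₂ C₁ C₂,
      pat3C_union_oneSided h₁ h₂ hS hC₁ hC₂ hb hs ht hbs hbt hst (g₁.trans hE₁) (g₂.trans hE₂),
      pat3C_union_oneSided h₁ h₂ hS hC₁ hC₂ hb hs ht hbs hbt hst (Finset.sdiff_subset.trans hE₁)
        (Finset.sdiff_subset.trans hE₂)]
    have e1 : (apExpC E₁ C₁ γ₁ = μ + 2 * Fintype.card V - apExpC E₂ C₂ γ₂) ↔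
        (apExpC (E₁ ∪ E₂) (C₁ ∪ C₂) (γ₁ ∪ γ₂) = μ) := by omega
    have e2 : (apExpC E₁ C₁ γ₁ + 1 = μ + 2 * Fintype.card V - apExpC E₂ C₂ γ₂) ↔
        (apExpC (E₁ ∪ E₂) (C₁ ∪ C₂) (γ₁ ∪ γ₂) + 1 = μ) := by omega
    rw [ite_eq_ite_of_iff e1 rfl, ite_eq_ite_of_iff e2 rfl]
  · refine le_of_eq (Finset.sum_eq_zero fun γ₁ hγ₁ => ?_).symm
    have g₁ := Finset.mem_powerset.1 hγ₁
    have hexp := apExpC_series hdN h₁ h₂ hS hE₁ hE₂ hC₁ hC₂ g₁ g₂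
    rw [if_neg (by omega), if_neg (by omega), add_zero]

end OneSidedC

/-! ### The steps -/

section StepsC

variable [Fintype V]

/-- **STEP P2 on minors, family form**: two-mark side any `(x, y)`-part `N₁`, three-mark side the two-terminal series–parallel
network `N₂` with inner mark `s`; all fourteen `famT12` members are nonnegative on the glued minor. [cite: AyyerLinussonRavichandran2025, §7 (p. 22)] -/
theorem famT12C_par_step {N₁ N₂ E₁ C₁ E₂ C₂ : Finset (Sym2 V)} {x y s : V} (hdN : Disjoint N₁ N₂)
    (hV : ∀ z : V, (∃ e ∈ N₁, z ∈ e) → (∃ e ∈ N₂, z ∈ e) → z = x ∨ z = y) (hxy : x ≠ y) (h₂ : IsTTSP N₂ x y)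
    (hE₁ : E₁ ⊆ N₁) (hC₁ : C₁ ⊆ N₁) (hE₂ : E₂ ⊆ N₂) (hC₂ : C₂ ⊆ N₂)
    (hs : ∃ e ∈ N₂, s ∈ e) (hsx : s ≠ x) (hsy : s ≠ y) (w : ℕ → ℝ) (hw : ∀ n, 0 ≤ w n) (i : ℕ) :
    0 ≤ mval2C w (E₁ ∪ E₂) (C₁ ∪ C₂) x y s (famGet famT12 i) := by
  by_cases hi : famT12.length ≤ i
  · rw [famGet_of_le hi, mval2C_zero]
  have hi' : i < famT12.length := lt_of_not_ge hi
  have hS : {z : V | ∃ e ∈ N₁, z ∈ e} ∩ {z : V | ∃ e ∈ N₂, z ∈ e} ⊆ ({x, y} : Set V) := fun z hz => by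
    rcases hV z hz.1 hz.2 with h | h <;> simp [h]
  have hsV : s ∉ {z : V | ∃ e ∈ N₁, z ∈ e} := fun h => by
    rcases hV s h hs with h' | h'
    · exact hsx h'
    · exact hsy h'
  exact mval2C_par_nonneg hdN (spanE_mem N₁) (spanE_mem N₂) hE₁ hC₁ hE₂ hC₂ hS hxy hsV hsx hsy
    (G := fun a' a'' => famGet famT12 (selT12Par i a' a'').1) (m := fun a' a'' => (selT12Par i a' a'').2.1)
    (k := fun a' a'' => (selT12Par i a' a'').2.2) (fun a' a'' => (certGlueFam_spec famT12_cert_par hi' a' a'').1)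
    (fun a' a'' => (certGlueFam_spec famT12_cert_par hi' a' a'').2) (fun a' a'' w' hw' => famT12C_nonneg h₂ hE₂ hC₂ hs hsx hsy hw' _)
    w hw

/-- **STEP S1 on minors:** the placement (terminal, terminal, inner vertex) is good on every minor `(E, C)` of `N`.
[cite: AyyerLinussonRavichandran2025, §7 (p. 22)] -/
theorem spGoodC_inner {N E C : Finset (Sym2 V)} {x y s : V} (hN : IsTTSP N x y) (hE : E ⊆ N) (hC : C ⊆ N)
    (hs : ∃ e ∈ N, s ∈ e) (hsx : s ≠ x) (hsy : s ≠ y) : SPGoodC E C x y s :=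
  SPGoodC.of_mval2 (fun _ hw => famT12C_nonneg hN hE hC hs hsx hsy hw 0) (fun _ hw => famT12C_nonneg hN hE hC hs hsx hsy hw 1)
    (fun _ hw => famT12C_nonneg hN hE hC hs hsx hsy hw 2) (fun _ hw => famT12C_nonneg hN hE hC hs hsx hsy hw 3)

/-- **STEP P2 on minors (cut through two marks).** [cite: AyyerLinussonRavichandran2025, §7 (p. 22)] -/
theorem spGoodC_parTwo {N₁ N₂ E₁ C₁ E₂ C₂ : Finset (Sym2 V)} {x y s : V} (hdN : Disjoint N₁ N₂)
    (hV : ∀ z : V, (∃ e ∈ N₁, z ∈ e) → (∃ e ∈ N₂, z ∈ e) → z = x ∨ z = y) (hxy : x ≠ y) (h₂ : IsTTSP N₂ x y)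
    (hE₁ : E₁ ⊆ N₁) (hC₁ : C₁ ⊆ N₁) (hE₂ : E₂ ⊆ N₂) (hC₂ : C₂ ⊆ N₂)
    (hs : ∃ e ∈ N₂, s ∈ e) (hsx : s ≠ x) (hsy : s ≠ y) : SPGoodC (E₁ ∪ E₂) (C₁ ∪ C₂) x y s :=
  SPGoodC.of_mval2 (fun w hw => famT12C_par_step hdN hV hxy h₂ hE₁ hC₁ hE₂ hC₂ hs hsx hsy w hw 0)
    (fun w hw => famT12C_par_step hdN hV hxy h₂ hE₁ hC₁ hE₂ hC₂ hs hsx hsy w hw 1)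
    (fun w hw => famT12C_par_step hdN hV hxy h₂ hE₁ hC₁ hE₂ hC₂ hs hsx hsy w hw 2)
    (fun w hw => famT12C_par_step hdN hV hxy h₂ hE₁ hC₁ hE₂ hC₂ hs hsx hsy w hw 3)

/-- **STEP CS on minors (a mark separating the other two; unconditional).** [cite: AyyerLinussonRavichandran2025, §7 (p. 22)] -/
theorem spGoodC_cutS {N₁ N₂ E₁ C₁ E₂ C₂ : Finset (Sym2 V)} {x y s : V} (hdN : Disjoint N₁ N₂)
    (hV : ∀ z : V, (∃ e ∈ N₁, z ∈ e) → (∃ e ∈ N₂, z ∈ e) → z = s)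
    (hE₁ : E₁ ⊆ N₁) (hC₁ : C₁ ⊆ N₁) (hE₂ : E₂ ⊆ N₂) (hC₂ : C₂ ⊆ N₂)
    (hx : ∃ e ∈ N₁, x ∈ e) (hy : ∃ e ∈ N₂, y ∈ e) (hxs : x ≠ s) (hys : y ≠ s) : SPGoodC (E₁ ∪ E₂) (C₁ ∪ C₂) x y s := by
  have hS : {z : V | ∃ e ∈ N₁, z ∈ e} ∩ {z : V | ∃ e ∈ N₂, z ∈ e} ⊆ ({s} : Set V) := fun z hz =>
    Set.mem_singleton_iff.2 (hV z hz.1 hz.2)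
  have hxV : x ∉ {z : V | ∃ e ∈ N₂, z ∈ e} := fun h => hxs (hV x hx h)
  have hyV : y ∉ {z : V | ∃ e ∈ N₁, z ∈ e} := fun h => hys (hV y h hy)
  have hxy : x ≠ y := fun h => hxs (hV x hx (h ▸ hy))
  exact SPGoodC.of_mul Nat.one_pos Nat.one_pos Nat.one_pos Nat.one_pos
    (cutSTsymC_level_nonneg hdN (spanE_mem N₁) (spanE_mem N₂) hE₁ hC₁ hE₂ hC₂ hS hxV hyV hxs hys hxy)
    (cutSStarC_level_nonneg hdN (spanE_mem N₁) (spanE_mem N₂) hE₁ hC₁ hE₂ hC₂ hS hxV hyV hxs hys hxy)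
    (cutSStarYC_level_nonneg hdN (spanE_mem N₁) (spanE_mem N₂) hE₁ hC₁ hE₂ hC₂ hS hxV hyV hxs hys hxy)
    (cutSStarSC_level_nonneg hdN (spanE_mem N₁) (spanE_mem N₂) hE₁ hC₁ hE₂ hC₂ hS hxV hyV hxs hys hxy)

/-- **STEP C1 on minors (one-vertex gluing at an unmarked vertex, marks `2 | 1`).** [cite: AyyerLinussonRavichandran2025, §7 (p. 22)] -/
theorem spGoodC_cut1 {N₁ N₂ E₁ C₁ E₂ C₂ : Finset (Sym2 V)} {w x y s : V} (hdN : Disjoint N₁ N₂)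
    (hV : ∀ z : V, (∃ e ∈ N₁, z ∈ e) → (∃ e ∈ N₂, z ∈ e) → z = w)
    (hE₁ : E₁ ⊆ N₁) (hC₁ : C₁ ⊆ N₁) (hE₂ : E₂ ⊆ N₂) (hC₂ : C₂ ⊆ N₂)
    (hx : ∃ e ∈ N₁, x ∈ e) (hs : ∃ e ∈ N₁, s ∈ e)
    (hy : ∃ e ∈ N₂, y ∈ e) (hxw : x ≠ w) (hsw : s ≠ w) (hyw : y ≠ w) (hA : SPGoodC E₁ C₁ x w s) :
    SPGoodC (E₁ ∪ E₂) (C₁ ∪ C₂) x y s := by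
  have hS : {z : V | ∃ e ∈ N₁, z ∈ e} ∩ {z : V | ∃ e ∈ N₂, z ∈ e} ⊆ ({w} : Set V) := fun z hz =>
    Set.mem_singleton_iff.2 (hV z hz.1 hz.2)
  have hxV : x ∉ {z : V | ∃ e ∈ N₂, z ∈ e} := fun h => hxw (hV x hx h)
  have hsV : s ∉ {z : V | ∃ e ∈ N₂, z ∈ e} := fun h => hsw (hV s hs h)
  have hyV : y ∉ {z : V | ∃ e ∈ N₁, z ∈ e} := fun h => hyw (hV y h hy)
  have hxy : x ≠ y := fun h => hxw (hV x hx (h ▸ hy))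
  have hsy : s ≠ y := fun h => hsw (hV s hs (h ▸ hy))
  exact SPGoodC.of_mul Nat.two_pos Nat.two_pos Nat.one_pos Nat.two_pos
    (cut1TsymC_level_nonneg hdN (spanE_mem N₁) (spanE_mem N₂) hE₁ hC₁ hE₂ hC₂ hS hxV hsV hyV hxw hyw hxy hsw hsy
      fun μ => (hA μ).1)
    (cut1StarC_level_nonneg hdN (spanE_mem N₁) (spanE_mem N₂) hE₁ hC₁ hE₂ hC₂ hS hxV hsV hyV hxw hyw hxy hsw hsy
      fun μ => (hA μ).2.1)
    (cut1StarYC_level_nonneg hdN (spanE_mem N₁) (spanE_mem N₂) hE₁ hC₁ hE₂ hC₂ hS hxV hsV hyV hxw hyw hxy hsw hsy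
      fun μ => (hA μ).2.2.1)
    (cut1StarSC_level_nonneg hdN (spanE_mem N₁) (spanE_mem N₂) hE₁ hC₁ hE₂ hC₂ hS hxV hsV hyV hxw hyw hxy hsw hsy
      fun μ => (hA μ).2.2.2)

/-- **STEP O1 on minors (one-vertex gluing, all marks on one side).** [cite: AyyerLinussonRavichandran2025, §7 (p. 22)] -/
theorem spGoodC_oneSided {N₁ N₂ E₁ C₁ E₂ C₂ : Finset (Sym2 V)} {m b s t : V} (hdN : Disjoint N₁ N₂)
    (hV : ∀ z : V, (∃ e ∈ N₁, z ∈ e) → (∃ e ∈ N₂, z ∈ e) → z = m)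
    (hE₁ : E₁ ⊆ N₁) (hC₁ : C₁ ⊆ N₁) (hE₂ : E₂ ⊆ N₂) (hC₂ : C₂ ⊆ N₂)
    (hb : ∃ e ∈ N₁, b ∈ e) (hs : ∃ e ∈ N₁, s ∈ e)
    (ht : ∃ e ∈ N₁, t ∈ e) (hbs : b ≠ s) (hbt : b ≠ t) (hst : s ≠ t) (hA : SPGoodC E₁ C₁ b s t) :
    SPGoodC (E₁ ∪ E₂) (C₁ ∪ C₂) b s t := by
  have hS : {z : V | ∃ e ∈ N₁, z ∈ e} ∩ {z : V | ∃ e ∈ N₂, z ∈ e} ⊆ ({m} : Set V) := fun z hz =>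
    Set.mem_singleton_iff.2 (hV z hz.1 hz.2)
  have side : ∀ p : V, (∃ e ∈ N₁, p ∈ e) → p ∉ {z : V | ∃ e ∈ N₂, z ∈ e} ∨ p = m := fun p hp => by
    by_cases hpm : p = m
    · exact Or.inr hpm
    · exact Or.inl fun h => hpm (hV p hp h)
  intro μ
  exact ⟨lev2C_union_oneSided_nonneg hdN (spanE_mem N₁) (spanE_mem N₂) hS hE₁ hC₁ hE₂ hC₂ (side b hb) (side s hs) (side t ht)
      hbs hbt hst _ (fun ν => (hA ν).1) μ,
    lev2C_union_oneSided_nonneg hdN (spanE_mem N₁) (spanE_mem N₂) hS hE₁ hC₁ hE₂ hC₂ (side b hb) (side s hs) (side t ht)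
      hbs hbt hst _ (fun ν => (hA ν).2.1) μ,
    lev2C_union_oneSided_nonneg hdN (spanE_mem N₁) (spanE_mem N₂) hS hE₁ hC₁ hE₂ hC₂ (side b hb) (side s hs) (side t ht)
      hbs hbt hst _ (fun ν => (hA ν).2.2.1) μ,
    lev2C_union_oneSided_nonneg hdN (spanE_mem N₁) (spanE_mem N₂) hS hE₁ hC₁ hE₂ hC₂ (side b hb) (side s hs) (side t ht)
      hbs hbt hst _ (fun ν => (hA ν).2.2.2) μ⟩

/-- **STEP CORNER on minors.** [cite: AyyerLinussonRavichandran2025, §7 (p. 22)] -/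
theorem spGoodC_corner {N₁ N₂ E₁ C₁ E₂ C₂ : Finset (Sym2 V)} {u v s t : V} (hdN : Disjoint N₁ N₂)
    (hV : ∀ z : V, (∃ e ∈ N₁, z ∈ e) → (∃ e ∈ N₂, z ∈ e) → z = u ∨ z = v) (h₁ : IsTTSP N₁ u v) (h₂ : IsTTSP N₂ u v)
    (hE₁ : E₁ ⊆ N₁) (hC₁ : C₁ ⊆ N₁) (hE₂ : E₂ ⊆ N₂) (hC₂ : C₂ ⊆ N₂)
    (hs : ∃ e ∈ N₁, s ∈ e) (ht : ∃ e ∈ N₂, t ∈ e) (hsu : s ≠ u) (hsv : s ≠ v) (htu : t ≠ u) (htv : t ≠ v) :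
    SPGoodC (E₁ ∪ E₂) (C₁ ∪ C₂) u s t := by
  have hS : {z : V | ∃ e ∈ N₁, z ∈ e} ∩ {z : V | ∃ e ∈ N₂, z ∈ e} ⊆ ({u, v} : Set V) := fun z hz => by
    rcases hV z hz.1 hz.2 with h | h <;> simp [h]
  have hs2 : s ∉ {z : V | ∃ e ∈ N₂, z ∈ e} := fun h => by
    rcases hV s hs h with h' | h'
    · exact hsu h'
    · exact hsv h'
  have ht1 : t ∉ {z : V | ∃ e ∈ N₁, z ∈ e} := fun h => by
    rcases hV t h ht with h' | h'
    · exact htu h'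
    · exact htv h'
  have hst : s ≠ t := fun h => ht1 (h ▸ hs)
  have huv : u ≠ v := h₁.ne
  have h4 : 0 < 4 := by norm_num
  exact SPGoodC.of_mul h4 h4 h4 h4
    (cornerTsymC_level_nonneg hdN (spanE_mem N₁) (spanE_mem N₂) hE₁ hC₁ hE₂ hC₂ hS huv hs2 ht1 hsu hsv htu htv hst h₁ h₂ hs ht)
    (cornerStarC_level_nonneg hdN (spanE_mem N₁) (spanE_mem N₂) hE₁ hC₁ hE₂ hC₂ hS huv hs2 ht1 hsu hsv htu htv hst h₁ h₂ hs ht)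
    (cornerStarSC_level_nonneg hdN (spanE_mem N₁) (spanE_mem N₂) hE₁ hC₁ hE₂ hC₂ hS huv hs2 ht1 hsu hsv htu htv hst h₁ h₂ hs ht)
    (cornerStarTC_level_nonneg hdN (spanE_mem N₁) (spanE_mem N₂) hE₁ hC₁ hE₂ hC₂ hS huv hs2 ht1 hsu hsv htu htv hst h₁ h₂ hs ht)

/-- **STEP THETA on minors.** [cite: AyyerLinussonRavichandran2025, §7 (p. 22)] -/
theorem spGoodC_theta {NK N₁ N₂ EK CK E₁ C₁ E₂ C₂ : Finset (Sym2 V)} {u v b s t : V} (hdK1 : Disjoint NK N₁)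
    (hdK2 : Disjoint NK N₂) (hd12 : Disjoint N₁ N₂)
    (hVK1 : ∀ z : V, (∃ e ∈ NK, z ∈ e) → (∃ e ∈ N₁, z ∈ e) → z = u ∨ z = v)
    (hVK2 : ∀ z : V, (∃ e ∈ NK, z ∈ e) → (∃ e ∈ N₂, z ∈ e) → z = u ∨ z = v)
    (hV12 : ∀ z : V, (∃ e ∈ N₁, z ∈ e) → (∃ e ∈ N₂, z ∈ e) → z = u ∨ z = v)
    (hK : IsTTSP NK u v) (h₁ : IsTTSP N₁ u v) (h₂ : IsTTSP N₂ u v)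
    (hEK : EK ⊆ NK) (hCK : CK ⊆ NK) (hE₁ : E₁ ⊆ N₁) (hC₁ : C₁ ⊆ N₁) (hE₂ : E₂ ⊆ N₂) (hC₂ : C₂ ⊆ N₂)
    (hb : ∃ e ∈ NK, b ∈ e) (hs : ∃ e ∈ N₁, s ∈ e) (ht : ∃ e ∈ N₂, t ∈ e)
    (hbu : b ≠ u) (hbv : b ≠ v) (hsu : s ≠ u) (hsv : s ≠ v) (htu : t ≠ u) (htv : t ≠ v) :
    SPGoodC (EK ∪ E₁ ∪ E₂) (CK ∪ C₁ ∪ C₂) b s t := by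
  have pair : ∀ {A B : Finset (Sym2 V)}, (∀ z : V, (∃ e ∈ A, z ∈ e) → (∃ e ∈ B, z ∈ e) → z = u ∨ z = v) →
      {z : V | ∃ e ∈ A, z ∈ e} ∩ {z : V | ∃ e ∈ B, z ∈ e} ⊆ ({u, v} : Set V) := fun h z hz => by
    rcases h z hz.1 hz.2 with h' | h' <;> simp [h']
  have off : ∀ {A B : Finset (Sym2 V)} {p : V}, (∀ z : V, (∃ e ∈ A, z ∈ e) → (∃ e ∈ B, z ∈ e) → z = u ∨ z = v) →
      (∃ e ∈ A, p ∈ e) → p ≠ u → p ≠ v → p ∉ {z : V | ∃ e ∈ B, z ∈ e} := fun h hp hpu hpv hpB => by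
    rcases h _ hp hpB with h' | h'
    · exact hpu h'
    · exact hpv h'
  have off' : ∀ {A B : Finset (Sym2 V)} {p : V}, (∀ z : V, (∃ e ∈ A, z ∈ e) → (∃ e ∈ B, z ∈ e) → z = u ∨ z = v) →
      (∃ e ∈ B, p ∈ e) → p ≠ u → p ≠ v → p ∉ {z : V | ∃ e ∈ A, z ∈ e} := fun h hp hpu hpv hpA => by
    rcases h _ hpA hp with h' | h'
    · exact hpu h'
    · exact hpv h'
  have hb1 := off hVK1 hb hbu hbv
  have hb2 := off hVK2 hb hbu hbv
  have hsK := off' hVK1 hs hsu hsv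
  have hs2 := off hV12 hs hsu hsv
  have htK := off' hVK2 ht htu htv
  have ht1 := off' hV12 ht htu htv
  have hbs : b ≠ s := fun h => hb1 (h ▸ hs)
  have hbt : b ≠ t := fun h => hb2 (h ▸ ht)
  have hst : s ≠ t := fun h => hs2 (h ▸ ht)
  have huv : u ≠ v := hK.ne
  exact SPGoodC.of_mul (by norm_num) (by norm_num) (by norm_num) (by norm_num)
    (thetaTsymC_level_nonneg hdK1 hdK2 hd12 (spanE_mem NK) (spanE_mem N₁) (spanE_mem N₂) (pair hVK1) (pair hVK2) (pair hV12)
      huv hEK hCK hE₁ hC₁ hE₂ hC₂ hb1 hb2 hsK hs2 htK ht1 hbu hbv hsu hsv htu htv hbs hbt hst hK h₁ h₂ hb hs ht)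
    (thetaStarC_level_nonneg hdK1 hdK2 hd12 (spanE_mem NK) (spanE_mem N₁) (spanE_mem N₂) (pair hVK1) (pair hVK2) (pair hV12)
      huv hEK hCK hE₁ hC₁ hE₂ hC₂ hb1 hb2 hsK hs2 htK ht1 hbu hbv hsu hsv htu htv hbs hbt hst hK h₁ h₂ hb hs ht)
    (thetaStarC_apex₁_level_nonneg hdK1 hdK2 hd12 (spanE_mem NK) (spanE_mem N₁) (spanE_mem N₂) (pair hVK1) (pair hVK2)
      (pair hV12) huv hEK hCK hE₁ hC₁ hE₂ hC₂ hb1 hb2 hsK hs2 htK ht1 hbu hbv hsu hsv htu htv hbs hbt hst hK h₁ h₂ hb hs ht)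
    (thetaStarC_apex₂_level_nonneg hdK1 hdK2 hd12 (spanE_mem NK) (spanE_mem N₁) (spanE_mem N₂) (pair hVK1) (pair hVK2)
      (pair hV12) huv hEK hCK hE₁ hC₁ hE₂ hC₂ hb1 hb2 hsK hs2 htK ht1 hbu hbv hsu hsv htu htv hbs hbt hst hK h₁ h₂ hb hs ht)

/-- **STEP RING on minors.** [cite: AyyerLinussonRavichandran2025, §7 (p. 22)] -/
theorem spGoodC_ring {NK N₁ N₂ EK CK E₁ C₁ E₂ C₂ : Finset (Sym2 V)} {u v w b s t : V} (hdK1 : Disjoint NK N₁)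
    (hdK2 : Disjoint NK N₂) (hd12 : Disjoint N₁ N₂) (hVK1 : ∀ z : V, (∃ e ∈ NK, z ∈ e) → (∃ e ∈ N₁, z ∈ e) → z = u)
    (hV12 : ∀ z : V, (∃ e ∈ N₁, z ∈ e) → (∃ e ∈ N₂, z ∈ e) → z = w)
    (hVK2 : ∀ z : V, (∃ e ∈ NK, z ∈ e) → (∃ e ∈ N₂, z ∈ e) → z = v)
    (hu2 : ¬ ∃ e ∈ N₂, u ∈ e) (hv1 : ¬ ∃ e ∈ N₁, v ∈ e) (huw : u ≠ w) (hvw : v ≠ w)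
    (hK : IsTTSP NK v u) (h₁ : IsTTSP N₁ u w) (h₂ : IsTTSP N₂ w v)
    (hEK : EK ⊆ NK) (hCK : CK ⊆ NK) (hE₁ : E₁ ⊆ N₁) (hC₁ : C₁ ⊆ N₁) (hE₂ : E₂ ⊆ N₂) (hC₂ : C₂ ⊆ N₂)
    (hb : ∃ e ∈ NK, b ∈ e) (hs : ∃ e ∈ N₁, s ∈ e) (ht : ∃ e ∈ N₂, t ∈ e)
    (hbu : b ≠ u) (hbv : b ≠ v) (hsu : s ≠ u) (hsw : s ≠ w) (htv : t ≠ v) (htw : t ≠ w) :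
    SPGoodC (EK ∪ E₁ ∪ E₂) (CK ∪ C₁ ∪ C₂) b s t := by
  have pK1 : {z : V | ∃ e ∈ NK, z ∈ e} ∩ {z : V | ∃ e ∈ N₁, z ∈ e} ⊆ ({u} : Set V) := fun z hz =>
    Set.mem_singleton_iff.2 (hVK1 z hz.1 hz.2)
  have p12 : {z : V | ∃ e ∈ N₁, z ∈ e} ∩ {z : V | ∃ e ∈ N₂, z ∈ e} ⊆ ({w} : Set V) := fun z hz =>
    Set.mem_singleton_iff.2 (hV12 z hz.1 hz.2)
  have pK2 : {z : V | ∃ e ∈ NK, z ∈ e} ∩ {z : V | ∃ e ∈ N₂, z ∈ e} ⊆ ({v} : Set V) := fun z hz =>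
    Set.mem_singleton_iff.2 (hVK2 z hz.1 hz.2)
  have huv : u ≠ v := hK.ne.symm
  have hb1 : b ∉ {z : V | ∃ e ∈ N₁, z ∈ e} := fun h => hbu (hVK1 b hb h)
  have hb2 : b ∉ {z : V | ∃ e ∈ N₂, z ∈ e} := fun h => hbv (hVK2 b hb h)
  have hsK : s ∉ {z : V | ∃ e ∈ NK, z ∈ e} := fun h => hsu (hVK1 s h hs)
  have hs2 : s ∉ {z : V | ∃ e ∈ N₂, z ∈ e} := fun h => hsw (hV12 s hs h)
  have htK : t ∉ {z : V | ∃ e ∈ NK, z ∈ e} := fun h => htv (hVK2 t h ht)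
  have ht1 : t ∉ {z : V | ∃ e ∈ N₁, z ∈ e} := fun h => htw (hV12 t h ht)
  have hsv : s ≠ v := fun h => hv1 (h ▸ hs)
  have htu : t ≠ u := fun h => hu2 (h ▸ ht)
  have hbs : b ≠ s := fun h => hb1 (h ▸ hs)
  have hbt : b ≠ t := fun h => hb2 (h ▸ ht)
  have hst : s ≠ t := fun h => hs2 (h ▸ ht)
  have hu2' : u ∉ {z : V | ∃ e ∈ N₂, z ∈ e} := hu2
  have hv1' : v ∉ {z : V | ∃ e ∈ N₁, z ∈ e} := hv1
  exact SPGoodC.of_mul (by norm_num) (by norm_num) (by norm_num) (by norm_num)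
    (ringTsymC_level_nonneg hdK1 hdK2 hd12 (spanE_mem NK) (spanE_mem N₁) (spanE_mem N₂) pK1 p12 pK2 hu2' hv1' huv huw hvw hEK hCK
      hE₁ hC₁ hE₂ hC₂ hb1 hb2 hsK hs2 htK ht1 hbu hbv hsu hsv hsw htu htv htw hbs hbt hst hK h₁ h₂ hb hs ht)
    (ringStarC_level_nonneg hdK1 hdK2 hd12 (spanE_mem NK) (spanE_mem N₁) (spanE_mem N₂) pK1 p12 pK2 hu2' hv1' huv huw hvw hEK hCK
      hE₁ hC₁ hE₂ hC₂ hb1 hb2 hsK hs2 htK ht1 hbu hbv hsu hsv hsw htu htv htw hbs hbt hst hK h₁ h₂ hb hs ht)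
    (ringStarC_apex₁_level_nonneg hdK1 hdK2 hd12 (spanE_mem NK) (spanE_mem N₁) (spanE_mem N₂) pK1 p12 pK2 hu2' huv huw hvw hEK
      hCK hE₁ hC₁ hE₂ hC₂ hb1 hb2 hsK hs2 htK ht1 hbu hbv hsu hsw htu htv htw hbs hbt hst hK h₁ h₂ hb hs ht)
    (ringStarC_apex₂_level_nonneg hdK1 hdK2 hd12 (spanE_mem NK) (spanE_mem N₁) (spanE_mem N₂) pK1 p12 pK2 hv1' huv huw hvw hEK
      hCK hE₁ hC₁ hE₂ hC₂ hb1 hb2 hsK hs2 htK ht1 hbu hbv hsu hsv hsw htv htw hbs hbt hst hK h₁ h₂ hb hs ht)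

end StepsC

end FK

end Summit.CriticalPhenomena.PercolationContinuityZ3.Theorems
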